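import Summits.BirchSwinnertonDyer.BirchSwinnertonDyer.Theorems.BiquadraticEisensteinDescentHeegnerTwistCouplingInSupplyFrobeniusFan
import Summits.BirchSwinnertonDyer.BirchSwinnertonDyer.Theorems.BiquadraticEisensteinDescentHeegnerTwistCouplingInSupplySylvesterCornerClosed
import Literature.NumberTheory.LFunctions.ImaginaryQuadraticClassNumberHalfLogBound
import HarnessLib

set_option linter.dupNamespace false -- `Summit.BirchSwinnertonDyer.BirchSwinnertonDyer.Theorems.…` (summit = sub, D-0017)
set_option autoImplicit false

/-!
# Crux `HeegnerTwistCouplingInSupply` (stmt-BirchSwinnertonDyer-21381) — the SYLVESTER corner `W_p : y² + py = x³` through the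
# FROBENIUS FAN: a `3`-free Hurwitz digit `3 ∤ H(4p − t²)` (`3 ∥ t`) gives the crux CONCLUSION at `(W_p, p)` for EVERY prime `p ≡ 8 (mod 9)`
# — no bound on `p` — modulo the unit-form `3`-descent `hDescU`, the cube–class collapse `hCube`, and Burungale–Tian
# (card `chebotarev-digit-supply`, cruxidea seat 1 g38: `CornerTheorem` with `DigitSupply` discharged)

Route `BiquadraticEisensteinDescent` (cell `pub/bsd-wall`, width seat `bsd-wall-cm-bed-w4` g30; `--supports` 21381, helper). THEOREMS ONLY
(no `def`, no named fact, no `sorry`). BSD is not proved by any of this; the crux (residual C⁺) and its registered stubs are untouched.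

Companion of `…FrobeniusFan` (the class-number half: `3 ∤ num H(4p − t²) ⟹` a Frobenius field `K = ℚ(√(t² − 4p))` with `3 ∤ h_K`,
`(d_K/3) = (d_K/p) = +1`, `4 < |d_K| < 4p`). Here the field is fed to the Sylvester door of `…SylvesterCorner*` (w4 g26):

* §1 `classNumber_lt_of_natAbs_discr_lt_four_mul` — an imaginary quadratic `K` with `4 < |d_K| < 4p`, `3 ≤ p`, has `h_K < p`
  (Louboutin's `h_K ≤ π⁻¹√|d_K|(½ log|d_K| + 1.3)`, tree `classNumber_le_of_discr_lt_neg_four`, and `log p ≤ 4(p^{1/4} − 1)`), so the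
  crux's `p ∤ h(K′)` is FREE on the whole fan (`|d_K| < 4p`).
* §2 ★★ `cruxConclusion_of_frobenius` — for a prime `p ≡ 8 (mod 9)` and a trace `t` with `3 ∣ t`, `9 ∤ t`, `t² < 4p`, `3 ∤ num H(4p − t²)`:
  the CONCLUSION of crux 21381 at `(W_p, p)` (a Heegner `K′` of `N(W_p)` with `4 < |d_{K′}|`, `L(W_p^{(d_{K′})}, 1) ≠ 0`, `h(K′) < p`,
  `p ∤ h(K′)`), `K′` the Frobenius field — MODULO three hypotheses, each an INPUT never asserted: `hDescU` (the `3`-isogeny descent on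
  `y² = x³ + 16p²d³` in unit form, as in `…SylvesterCornerCruxOnFamily`), `hCube` (the card's `CubeClassCollapse`: for a Frobenius field
  with `3 ∥ t` and `3 ∤ h_K` some unit of `ℚ(√(−3d_K))` is not a cube modulo the inert `p` — class field theory over `K`: the Kummer
  cubic `K(∛ε)` has conductor dividing `9` when `3 ∤ h_K`, its Artin symbol at the principal prime `((t + c√d_K)/2)` of norm `p` is read
  off `π/π̄ mod 𝔮²`, and equals `1` iff `9 ∣ t`; numerics 5378/5378 for `p < 2500`), and `hBT` (Burungale–Tian's corank-zero converse);
  ★★ `cruxConclusion_of_digit` — the same from the card's DIGIT (`3 ∤ num Σ_{t ≡ 3 (27)} H(4p − t²)`);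
  ★★ `cruxOnSylvesterCorner_of_digit` — for EVERY prime `p ≡ 8 (mod 9)` with non-zero digit, in the binder shape of
  `cruxOnSylvesterCorner_closed_lt5` with the bound `p < 10⁵` REPLACED by the digit (the infinite-family reading, the crux BODY for
  `W = W_n` and the instance `p = 53` are in the sequel `…FrobeniusFanCornerFamily`).

HONEST FRAMING: on the card's Chebotarev set `𝒫 = {p ≡ 8 (9) : digit ≠ 0}` (density ≈ 2/3 numerically; `DigitSetInfinite` needs the
mod-27 Galois representation of `27.2.e.a` + Chebotarev — NOT in the tree) this is the corner with citable inputs only; the digit-zero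
primes, the crux C⁺, W-ALL and BSD are untouched. [cite: CohenPazuki2009, §2] [cite: BurungaleTian2026, Thm. 1.1]
[cite: Louboutin2006RelativeClassNumbers, Thm 1 (2) p. 200] [cite: Cohen1993, §5.3.2 Lemma 5.3.7, p. 234] [cite: Cox2013, §7.D Thm. 7.24; §9.A]
[cite: GrossLMS1991, §1]
-/

noncomputable section

open scoped Classical NumberField

namespace Summit.BirchSwinnertonDyer.BirchSwinnertonDyer.Theorems.FrobeniusFan

open _root_.WeierstrassCurve Literature.NumberTheory.EllipticCurves
open Literature.NumberTheory.QuadraticFields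
open Literature.NumberTheory.Automorphic.Brandt (conductor tOf nOf conductor_pos)
open Summit.BirchSwinnertonDyer.BirchSwinnertonDyer.Theorems.SylvesterCorner

/-! ## §1 `4 < |d_K| < 4p`, `3 ≤ p` ⟹ `h_K < p` -/

section ClassNumberBound

variable {K : Type*} [Field K] [NumberField K]

/-- The numerical heart: for real `x`, `p` with `4 < x < 4p` and `3 ≤ p`, `π⁻¹·√x·(½ log x + 1.3) < p` (`log p = 4 log p^{1/4} ≤ 4(p^{1/4} − 1)`,
`log 4 < 1.3863`, so the left side is `< 4u³/π ≤ u⁴ = p` with `u = p^{1/4} ≥ 3^{1/4} > 4/π`). [folklore] -/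
theorem sqrt_mul_half_log_lt {x p : ℝ} (hx4 : 4 < x) (hxp : x < 4 * p) (hp : 3 ≤ p) :
    Real.pi⁻¹ * Real.sqrt x * (Real.log x / 2 + 1.3) < p := by
  have hp0 : 0 < p := by linarith
  have hx0 : 0 < x := by linarith
  set u : ℝ := Real.sqrt (Real.sqrt p) with hu_def
  have hs0 : 0 < Real.sqrt p := Real.sqrt_pos.2 hp0
  have hu0 : 0 < u := Real.sqrt_pos.2 hs0
  have hu2 : u ^ 2 = Real.sqrt p := Real.sq_sqrt hs0.le
  have hu4 : u ^ 4 = p := by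
    have : u ^ 4 = (u ^ 2) ^ 2 := by ring
    rw [this, hu2, Real.sq_sqrt hp0.le]
  -- `log x < log 4 + 4 (u - 1)`
  have hlog4 : Real.log 4 < 1.3863 := by
    have h := Real.log_two_lt_d9
    have : Real.log 4 = 2 * Real.log 2 := by
      rw [show (4 : ℝ) = 2 ^ 2 by norm_num, Real.log_pow]; norm_num
    rw [this]; linarith
  have hlogp : Real.log p = 4 * Real.log u := by
    rw [← hu4, Real.log_pow]; norm_num
  have hlogu : Real.log u ≤ u - 1 := Real.log_le_sub_one_of_pos hu0
  have hlogx : Real.log x < Real.log 4 + Real.log p := by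
    rw [← Real.log_mul (by norm_num) hp0.ne']
    exact Real.log_lt_log hx0 hxp
  have hfac : Real.log x / 2 + 1.3 < 2 * u := by linarith
  have hfac0 : 0 < Real.log x / 2 + 1.3 := by
    have : 0 < Real.log x := Real.log_pos (by linarith)
    linarith
  -- `√x < 2 u²`
  have hsqrt : Real.sqrt x < 2 * u ^ 2 := by
    rw [hu2]
    calc Real.sqrt x < Real.sqrt (4 * p) := Real.sqrt_lt_sqrt hx0.le hxp
      _ = 2 * Real.sqrt p := by
        rw [Real.sqrt_mul (by norm_num), show Real.sqrt 4 = 2 by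
          rw [show (4 : ℝ) = 2 ^ 2 by norm_num, Real.sqrt_sq (by norm_num)]]
  have hπ := Real.pi_gt_d2
  have hπ0 : 0 < Real.pi⁻¹ := inv_pos.2 Real.pi_pos
  -- `u ≥ 1.28 > 4/π`
  have hu128 : 1.28 ≤ u := by
    by_contra hlt
    push Not at hlt
    have : u ^ 4 < 1.28 ^ 4 := by gcongr
    linarith [show (1.28 : ℝ) ^ 4 < 3 by norm_num]
  have hu3 : 0 < u ^ 3 := by positivity
  have hπinv : Real.pi⁻¹ ≤ (3.14 : ℝ)⁻¹ := by
    rw [inv_le_inv₀ Real.pi_pos (by norm_num)]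
    exact hπ.le
  have hratio : (4 : ℝ) * (3.14 : ℝ)⁻¹ ≤ u := by
    norm_num
    linarith
  calc Real.pi⁻¹ * Real.sqrt x * (Real.log x / 2 + 1.3)
      < Real.pi⁻¹ * (2 * u ^ 2) * (2 * u) := by
        gcongr
    _ = (4 * u ^ 3) * Real.pi⁻¹ := by ring
    _ ≤ (4 * u ^ 3) * (3.14 : ℝ)⁻¹ := by gcongr
    _ = u ^ 3 * (4 * (3.14 : ℝ)⁻¹) := by ring
    _ ≤ u ^ 3 * u := mul_le_mul_of_nonneg_left hratio hu3.le
    _ = p := by rw [← hu4]; ring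

/-- ★ **`h_K < p` when `4 < |d_K| < 4p`, `3 ≤ p`**, for an imaginary quadratic `K`: Louboutin's explicit bound
`h_K ≤ π⁻¹√|d_K|(½ log|d_K| + 1.3)` (tree `classNumber_le_of_discr_lt_neg_four`) and §1's numerics. So on the whole Frobenius fan
(`|d_K| < 4p`) the crux's `p ∤ h(K′)` is free. [cite: Louboutin2006RelativeClassNumbers, Thm 1 (2) p. 200] -/
theorem classNumber_lt_of_natAbs_discr_lt_four_mul (hK : IsImaginaryQuadratic K) (h4 : 4 < (NumberField.discr K).natAbs)
    {p : ℕ} (hp : 3 ≤ p) (hlt : (NumberField.discr K).natAbs < 4 * p) : NumberField.classNumber K < p := by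
  have hd : NumberField.discr K < -4 := by
    have := hK.discr_neg; omega
  have hle := Literature.NumberTheory.LFunctions.Louboutin2001.classNumber_le_of_discr_lt_neg_four hK.1 hd
  have hx4 : (4 : ℝ) < ((NumberField.discr K).natAbs : ℝ) := by exact_mod_cast h4
  have hxp : (((NumberField.discr K).natAbs : ℝ)) < 4 * (p : ℝ) := by exact_mod_cast hlt
  have hp' : (3 : ℝ) ≤ p := by exact_mod_cast hp
  have := hle.trans_lt (sqrt_mul_half_log_lt hx4 hxp hp')
  exact_mod_cast this

/-- `h_K < p ⟹ p ∤ h_K` on the fan. [folklore] -/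
theorem not_dvd_classNumber_of_natAbs_discr_lt_four_mul (hK : IsImaginaryQuadratic K) (h4 : 4 < (NumberField.discr K).natAbs)
    {p : ℕ} (hp : 3 ≤ p) (hlt : (NumberField.discr K).natAbs < 4 * p) : ¬ p ∣ NumberField.classNumber K := fun hdvd ↦
  absurd (Nat.le_of_dvd (NumberField.classNumber_pos (K := K)) hdvd)
    (not_le.mpr (classNumber_lt_of_natAbs_discr_lt_four_mul hK h4 hp hlt))

end ClassNumberBound

/-! ## §2 The Sylvester corner through the Frobenius fan, modulo `hDescU`, `hCube`, `hBT` -/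

section Corner

/-- ★ **The corner from a FROBENIUS FIELD.** For a prime `p ≡ 8 (mod 9)`, a trace `t` with `3 ∣ t`, `9 ∤ t`, and an imaginary quadratic
`K` with `d_K·c² = t² − 4p`, `4 < |d_K| < 4p`, `(d_K/3) = (d_K/p) = +1`, `3 ∤ h_K`: the CONCLUSION of crux 21381 at `(W_p, p)` with `K′ = K`
— Heegner for `N(W_p)` (prime support `{3, p}`), `L(W_p^{(d_K)}, 1) ≠ 0` (`hCube` feeds `hDescU`, then the Burungale–Tian door at `3`),
`h_K < p` (§1), `p ∤ h_K`. MODULO `hDescU`, `hCube`, `hBT` (inputs, never asserted). [cite: CohenPazuki2009, §2]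
[cite: BurungaleTian2026, Thm. 1.1] [cite: GrossLMS1991, §1] [cite: Louboutin2006RelativeClassNumbers, Thm 1 (2) p. 200] -/
theorem cruxConclusion_of_frobeniusField
    (hDescU : ∀ (p : ℕ) (K : Type) [Field K] [NumberField K], p.Prime → p % 9 = 8 →
      IsImaginaryQuadratic K → 4 < (NumberField.discr K).natAbs →
      jacobiSym (NumberField.discr K) 3 = 1 → jacobiSym (NumberField.discr K) p = 1 →
      ¬ 3 ∣ NumberField.classNumber K →
      (∀ (L : Type) [Field L] [NumberField L], Module.finrank ℚ L = 2 →
        NumberField.discr L = -3 * NumberField.discr K →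
        ∃ u : (𝓞 L)ˣ, ∀ x : 𝓞 L, (u : 𝓞 L) - x ^ 3 ∉ Ideal.span {(p : 𝓞 L)}) →
      ((⟨0, 0, (p : ℚ), 0, 0⟩ : WeierstrassCurve ℚ).quadraticTwist (NumberField.discr K : ℚ)).mordellWeilRank = 0 ∧
      ∀ c ∈ ((⟨0, 0, (p : ℚ), 0, 0⟩ : WeierstrassCurve ℚ).quadraticTwist (NumberField.discr K : ℚ)).sha,
        3 • c = 0 → c = 0)
    (hCube : ∀ (p : ℕ) (K : Type) [Field K] [NumberField K] (t : ℤ) (c : ℕ), p.Prime → p % 3 = 2 →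
      IsImaginaryQuadratic K → NumberField.discr K * (c : ℤ) ^ 2 = t ^ 2 - 4 * p → 3 ∣ t → ¬ 9 ∣ t →
      ¬ 3 ∣ NumberField.classNumber K →
      ∀ (L : Type) [Field L] [NumberField L], Module.finrank ℚ L = 2 →
        NumberField.discr L = -3 * NumberField.discr K →
        ∃ u : (𝓞 L)ˣ, ∀ x : 𝓞 L, (u : 𝓞 L) - x ^ 3 ∉ Ideal.span {(p : 𝓞 L)})
    (hBT : burungaleTian_analyticRank_eq_zero_of_selmerCorank_eq_zero_of_hasCM)
    {p : ℕ} (hp : p.Prime) (hp9 : p % 9 = 8) [(⟨0, 0, (p : ℚ), 0, 0⟩ : WeierstrassCurve ℚ).IsElliptic]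
    {t : ℤ} (h3t : 3 ∣ t) (h9t : ¬ 9 ∣ t) (K : Type) [Field K] [NumberField K] (hK : IsImaginaryQuadratic K)
    {c : ℕ} (hdK : NumberField.discr K * (c : ℤ) ^ 2 = t ^ 2 - 4 * p)
    (h4 : 4 < (NumberField.discr K).natAbs) (h4p : (NumberField.discr K).natAbs < 4 * p)
    (hJ3 : jacobiSym (NumberField.discr K) 3 = 1) (hJp : jacobiSym (NumberField.discr K) p = 1)
    (hh3 : ¬ 3 ∣ NumberField.classNumber K) :
    IsImaginaryQuadratic K ∧ 4 < (NumberField.discr K).natAbs ∧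
      SatisfiesHeegnerHypothesis ((⟨0, 0, (p : ℚ), 0, 0⟩ : WeierstrassCurve ℚ).conductorNorm ℤ) K ∧
      ((⟨0, 0, (p : ℚ), 0, 0⟩ : WeierstrassCurve ℚ).quadraticTwist (NumberField.discr K : ℚ)).entireLFunction 1 ≠ 0 ∧
      NumberField.classNumber K < p ∧ ¬ p ∣ NumberField.classNumber K := by
  have hp3 : p % 3 = 2 := by omega
  have hp2 : p ≠ 2 := by rintro rfl; omega
  have h3p : 3 ≤ p := by have := hp.two_le; omega
  refine ⟨hK, h4, ?_, ?_, classNumber_lt_of_natAbs_discr_lt_four_mul hK h4 h3p h4p,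
    not_dvd_classNumber_of_natAbs_discr_lt_four_mul hK h4 h3p h4p⟩
  · exact satisfiesHeegnerHypothesis_of_three_p hK.1 hp2 hJ3 hJp
      (fun r hr hrN ↦ eq_three_or_eq_of_prime_dvd_conductorNorm_W hp hr hrN)
  · have hd0 : (NumberField.discr K : ℚ) ≠ 0 := by
      have : NumberField.discr K ≠ 0 := by intro h0; rw [h0] at h4; simp at h4
      exact_mod_cast this
    obtain ⟨hE, hj, -⟩ := isElliptic_j_hasCM_twist hp.ne_zero hd0
    have hunits := hCube p K t c hp hp3 hK hdK h3t h9t hh3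
    obtain ⟨hrank, hsha⟩ := hDescU p K hp hp9 hK h4 hJ3 hJp hh3 hunits
    exact (L_one_ne_zero_of_desc_BT hBT _ hj hrank hsha).2

/-- ★★ **THE CORNER FROM A `3`-FREE HURWITZ CLASS NUMBER IN THE FAN.** For a prime `p ≡ 8 (mod 9)` and a trace `t` with `3 ∣ t`, `9 ∤ t`,
`t² < 4p` and `3 ∤ num H(4p − t²)`: the CONCLUSION of crux 21381 at `(W_p, p)` (a Heegner `K′` of `N(W_p)` — the Frobenius field
`ℚ(√(t² − 4p))` — with `4 < |d_{K′}|`, `L(W_p^{(d_{K′})}, 1) ≠ 0`, `h(K′) < p`, `p ∤ h(K′)`), MODULO `hDescU`, `hCube`, `hBT`. No bound on `p`.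
[cite: Cohen1993, §5.3.2 Lemma 5.3.7, p. 234] [cite: Cox2013, §7.D Thm. 7.24] [cite: CohenPazuki2009, §2] [cite: BurungaleTian2026, Thm. 1.1] -/
theorem cruxConclusion_of_frobenius
    (hDescU : ∀ (p : ℕ) (K : Type) [Field K] [NumberField K], p.Prime → p % 9 = 8 →
      IsImaginaryQuadratic K → 4 < (NumberField.discr K).natAbs →
      jacobiSym (NumberField.discr K) 3 = 1 → jacobiSym (NumberField.discr K) p = 1 →
      ¬ 3 ∣ NumberField.classNumber K →
      (∀ (L : Type) [Field L] [NumberField L], Module.finrank ℚ L = 2 →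
        NumberField.discr L = -3 * NumberField.discr K →
        ∃ u : (𝓞 L)ˣ, ∀ x : 𝓞 L, (u : 𝓞 L) - x ^ 3 ∉ Ideal.span {(p : 𝓞 L)}) →
      ((⟨0, 0, (p : ℚ), 0, 0⟩ : WeierstrassCurve ℚ).quadraticTwist (NumberField.discr K : ℚ)).mordellWeilRank = 0 ∧
      ∀ c ∈ ((⟨0, 0, (p : ℚ), 0, 0⟩ : WeierstrassCurve ℚ).quadraticTwist (NumberField.discr K : ℚ)).sha,
        3 • c = 0 → c = 0)
    (hCube : ∀ (p : ℕ) (K : Type) [Field K] [NumberField K] (t : ℤ) (c : ℕ), p.Prime → p % 3 = 2 →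
      IsImaginaryQuadratic K → NumberField.discr K * (c : ℤ) ^ 2 = t ^ 2 - 4 * p → 3 ∣ t → ¬ 9 ∣ t →
      ¬ 3 ∣ NumberField.classNumber K →
      ∀ (L : Type) [Field L] [NumberField L], Module.finrank ℚ L = 2 →
        NumberField.discr L = -3 * NumberField.discr K →
        ∃ u : (𝓞 L)ˣ, ∀ x : 𝓞 L, (u : 𝓞 L) - x ^ 3 ∉ Ideal.span {(p : 𝓞 L)})
    (hBT : burungaleTian_analyticRank_eq_zero_of_selmerCorank_eq_zero_of_hasCM)
    {p : ℕ} (hp : p.Prime) (hp9 : p % 9 = 8) [(⟨0, 0, (p : ℚ), 0, 0⟩ : WeierstrassCurve ℚ).IsElliptic]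
    {t : ℤ} (h3t : 3 ∣ t) (h9t : ¬ 9 ∣ t) (h : t ^ 2 < 4 * (p : ℤ))
    (hH : ¬ (3 : ℤ) ∣ (hurwitzClassNumber (4 * p - t ^ 2)).num) :
    ∃ (K : Type) (_ : Field K) (_ : NumberField K),
      IsImaginaryQuadratic K ∧ 4 < (NumberField.discr K).natAbs ∧
      SatisfiesHeegnerHypothesis ((⟨0, 0, (p : ℚ), 0, 0⟩ : WeierstrassCurve ℚ).conductorNorm ℤ) K ∧
      ((⟨0, 0, (p : ℚ), 0, 0⟩ : WeierstrassCurve ℚ).quadraticTwist (NumberField.discr K : ℚ)).entireLFunction 1 ≠ 0 ∧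
      NumberField.classNumber K < p ∧ ¬ p ∣ NumberField.classNumber K := by
  have hp3 : p % 3 = 2 := by omega
  have ht0 : t ≠ 0 := by rintro rfl; exact h9t (dvd_zero 9)
  obtain ⟨K, iF, iN, hK, hdK, h4, h4p, hJ3, hJp, hh3⟩ :=
    exists_frobeniusField_of_not_dvd_num hp hp3 h3t ht0 h (ℓ := 3) (by exact_mod_cast hH)
  exact ⟨K, iF, iN, cruxConclusion_of_frobeniusField hDescU hCube hBT hp hp9 h3t h9t K hK hdK h4 h4p hJ3 hJp hh3⟩

/-- ★★ **THE CORNER FROM THE CARD'S DIGIT.** For a prime `p ≡ 8 (mod 9)` whose slice `N₂₇(p, 3) = Σ_{t ≡ 3 (27), t² < 4p} H(4p − t²)` has a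
non-zero `3`-adic digit (`3 ∤ num N₂₇(p, 3)`): the CONCLUSION of crux 21381 at `(W_p, p)`, MODULO `hDescU`, `hCube`, `hBT` — the card's
`CornerTheorem` with `DigitSupply` discharged and `FrobeniusSylvesterCertificate` split as `hDescU ∧ hCube`. [cite: Cohen1993, §5.3.2 Lemma 5.3.7, p. 234]
[cite: Cox2013, §7.D Thm. 7.24] [cite: CohenPazuki2009, §2] [cite: BurungaleTian2026, Thm. 1.1] -/
theorem cruxConclusion_of_digit
    (hDescU : ∀ (p : ℕ) (K : Type) [Field K] [NumberField K], p.Prime → p % 9 = 8 →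
      IsImaginaryQuadratic K → 4 < (NumberField.discr K).natAbs →
      jacobiSym (NumberField.discr K) 3 = 1 → jacobiSym (NumberField.discr K) p = 1 →
      ¬ 3 ∣ NumberField.classNumber K →
      (∀ (L : Type) [Field L] [NumberField L], Module.finrank ℚ L = 2 →
        NumberField.discr L = -3 * NumberField.discr K →
        ∃ u : (𝓞 L)ˣ, ∀ x : 𝓞 L, (u : 𝓞 L) - x ^ 3 ∉ Ideal.span {(p : 𝓞 L)}) →
      ((⟨0, 0, (p : ℚ), 0, 0⟩ : WeierstrassCurve ℚ).quadraticTwist (NumberField.discr K : ℚ)).mordellWeilRank = 0 ∧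
      ∀ c ∈ ((⟨0, 0, (p : ℚ), 0, 0⟩ : WeierstrassCurve ℚ).quadraticTwist (NumberField.discr K : ℚ)).sha,
        3 • c = 0 → c = 0)
    (hCube : ∀ (p : ℕ) (K : Type) [Field K] [NumberField K] (t : ℤ) (c : ℕ), p.Prime → p % 3 = 2 →
      IsImaginaryQuadratic K → NumberField.discr K * (c : ℤ) ^ 2 = t ^ 2 - 4 * p → 3 ∣ t → ¬ 9 ∣ t →
      ¬ 3 ∣ NumberField.classNumber K →
      ∀ (L : Type) [Field L] [NumberField L], Module.finrank ℚ L = 2 →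
        NumberField.discr L = -3 * NumberField.discr K →
        ∃ u : (𝓞 L)ˣ, ∀ x : 𝓞 L, (u : 𝓞 L) - x ^ 3 ∉ Ideal.span {(p : 𝓞 L)})
    (hBT : burungaleTian_analyticRank_eq_zero_of_selmerCorank_eq_zero_of_hasCM)
    {p : ℕ} (hp : p.Prime) (hp9 : p % 9 = 8) [(⟨0, 0, (p : ℚ), 0, 0⟩ : WeierstrassCurve ℚ).IsElliptic]
    (hdigit : ¬ (3 : ℤ) ∣ (∑ t ∈ (Finset.Ioo (-(2 * (p : ℤ))) (2 * p)).filter (fun t ↦ t % 27 = 3 ∧ t ^ 2 < 4 * (p : ℤ)),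
      hurwitzClassNumber (4 * p - t ^ 2)).num) :
    ∃ (K : Type) (_ : Field K) (_ : NumberField K),
      IsImaginaryQuadratic K ∧ 4 < (NumberField.discr K).natAbs ∧
      SatisfiesHeegnerHypothesis ((⟨0, 0, (p : ℚ), 0, 0⟩ : WeierstrassCurve ℚ).conductorNorm ℤ) K ∧
      ((⟨0, 0, (p : ℚ), 0, 0⟩ : WeierstrassCurve ℚ).quadraticTwist (NumberField.discr K : ℚ)).entireLFunction 1 ≠ 0 ∧
      NumberField.classNumber K < p ∧ ¬ p ∣ NumberField.classNumber K := by
  have hp3 : p % 3 = 2 := by omega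
  have hS : ∀ t ∈ (Finset.Ioo (-(2 * (p : ℤ))) (2 * p)).filter (fun t ↦ t % 27 = 3 ∧ t ^ 2 < 4 * (p : ℤ)),
      3 ∣ t ∧ t ≠ 0 ∧ t ^ 2 < 4 * (p : ℤ) := by
    intro t ht
    rw [Finset.mem_filter] at ht
    exact ⟨by omega, by omega, ht.2.2⟩
  obtain ⟨t, ht, K, iF, iN, hK, hdK, h4, h4p, hJ3, hJp, hh3⟩ :=
    exists_frobeniusField_of_not_dvd_num_sum hp hp3 _ hS (ℓ := 3) (by exact_mod_cast hdigit)
  rw [Finset.mem_filter] at ht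
  exact ⟨K, iF, iN, cruxConclusion_of_frobeniusField hDescU hCube hBT hp hp9 (t := t) (by omega) (by omega) K hK hdK h4 h4p
    hJ3 hJp hh3⟩

/-- ★★ **THE SYLVESTER CORNER AT EVERY DIGIT-NON-ZERO PRIME `p ≡ 8 (mod 9)` — CLOSED form** (no instance binders; shape of
`cruxOnSylvesterCorner_closed_lt5` with the bound `p < 10⁵` REPLACED by the card's digit condition): `W_p` is elliptic and there is a
Heegner `K′` of `N(W_p)` with `4 < |d_{K′}|`, `L(W_p^{(d_{K′})}, 1) ≠ 0`, `h(K′) < p`, `p ∤ h(K′)`, MODULO `hDescU`, `hCube`, `hBT`. On the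
card's Chebotarev set this is the corner with citable inputs only. [cite: CohenPazuki2009, §2] [cite: BurungaleTian2026, Thm. 1.1]
[cite: Cohen1993, §5.3.2 Lemma 5.3.7, p. 234] -/
theorem cruxOnSylvesterCorner_of_digit
    (hDescU : ∀ (p : ℕ) (K : Type) [Field K] [NumberField K], p.Prime → p % 9 = 8 →
      IsImaginaryQuadratic K → 4 < (NumberField.discr K).natAbs →
      jacobiSym (NumberField.discr K) 3 = 1 → jacobiSym (NumberField.discr K) p = 1 →
      ¬ 3 ∣ NumberField.classNumber K →
      (∀ (L : Type) [Field L] [NumberField L], Module.finrank ℚ L = 2 →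
        NumberField.discr L = -3 * NumberField.discr K →
        ∃ u : (𝓞 L)ˣ, ∀ x : 𝓞 L, (u : 𝓞 L) - x ^ 3 ∉ Ideal.span {(p : 𝓞 L)}) →
      ((⟨0, 0, (p : ℚ), 0, 0⟩ : WeierstrassCurve ℚ).quadraticTwist (NumberField.discr K : ℚ)).mordellWeilRank = 0 ∧
      ∀ c ∈ ((⟨0, 0, (p : ℚ), 0, 0⟩ : WeierstrassCurve ℚ).quadraticTwist (NumberField.discr K : ℚ)).sha,
        3 • c = 0 → c = 0)
    (hCube : ∀ (p : ℕ) (K : Type) [Field K] [NumberField K] (t : ℤ) (c : ℕ), p.Prime → p % 3 = 2 →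
      IsImaginaryQuadratic K → NumberField.discr K * (c : ℤ) ^ 2 = t ^ 2 - 4 * p → 3 ∣ t → ¬ 9 ∣ t →
      ¬ 3 ∣ NumberField.classNumber K →
      ∀ (L : Type) [Field L] [NumberField L], Module.finrank ℚ L = 2 →
        NumberField.discr L = -3 * NumberField.discr K →
        ∃ u : (𝓞 L)ˣ, ∀ x : 𝓞 L, (u : 𝓞 L) - x ^ 3 ∉ Ideal.span {(p : 𝓞 L)})
    (hBT : burungaleTian_analyticRank_eq_zero_of_selmerCorank_eq_zero_of_hasCM) :
    ∀ (p : ℕ) (hp : p.Prime), p % 9 = 8 →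
      ¬ (3 : ℤ) ∣ (∑ t ∈ (Finset.Ioo (-(2 * (p : ℤ))) (2 * p)).filter (fun t ↦ t % 27 = 3 ∧ t ^ 2 < 4 * (p : ℤ)),
        hurwitzClassNumber (4 * p - t ^ 2)).num →
      haveI := isElliptic_sylvester hp.ne_zero
      ∃ (K : Type) (_ : Field K) (_ : NumberField K),
        IsImaginaryQuadratic K ∧ 4 < (NumberField.discr K).natAbs ∧
        SatisfiesHeegnerHypothesis ((⟨0, 0, (p : ℚ), 0, 0⟩ : WeierstrassCurve ℚ).conductorNorm ℤ) K ∧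
        ((⟨0, 0, (p : ℚ), 0, 0⟩ : WeierstrassCurve ℚ).quadraticTwist (NumberField.discr K : ℚ)).entireLFunction 1 ≠ 0 ∧
        NumberField.classNumber K < p ∧ ¬ p ∣ NumberField.classNumber K := by
  intro p hp hp9 hdigit
  haveI := isElliptic_sylvester hp.ne_zero
  exact cruxConclusion_of_digit hDescU hCube hBT hp hp9 hdigit

end Corner

end Summit.BirchSwinnertonDyer.BirchSwinnertonDyer.Theorems.FrobeniusFan
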